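import Literature.MathematicalPhysics.QuantumFieldTheory.Balaban1983to89.B13CoerciveAlongPencilLocated

/-!
# `Balaban1983to89.B13ClauseAndGreenLettersOnBallReg335Located` — T. Bałaban, *Propagators for lattice gauge theories in a background field*, Commun. Math. Phys. **99**
# (1985) 389–434 [Balaban1985BackgroundPropagators], (3.19)–(3.27) pp. 393–395, (3.34)–(3.35) p. 396, Thm 3.1 (3.42) p. 397, Thm 3.2 (3.48) p. 398, (3.46)–(3.47) p. 398,
# Thm 3.3 p. 399, Thm 3.4 and (3.50) p. 400, (3.62)–(3.64) p. 402, (3.84)–(3.86) p. 407, Thm 3.10 (3.107)–(3.108) pp. 415–416, Thm 3.11 p. 416; [Balaban1984PropagatorsII] (2.19),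
# p. 226, Lemma 2.1 (2.61) p. 234; [Balaban1988RG2Cluster] (2.5)–(2.7) pp. 12–13, p. 15: ★★★★ ROW 17's CLAUSE AND `G = Δ_a⁻¹`'s (3.108)-LETTERS ON ONE LOCATED CHART BALL
# AROUND EVERY COERCIVE MEMBER OF THE REGULAR CLASS (3.35), BEHIND ONE HIDDEN R-STATION RADIUS — the lane's modules 83 and 84 on (3.35) at the readings of record under
# a SINGLE existential (the general-centre analogue of dag-n10-w2 g4's `B13InverseLettersOnCoerciveBallAtOne` theorem 1).

THE DISPLAY.  This seat's `B13CoerciveAlongPencilReg335Located` (module 83 on (3.35): the clause on a located ball around every coercive member) and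
`B13GreenChainOnCoerciveBallReg335Located` §2 (module 84 on (3.35): G's letters on the coercivity ball) each conclude `∃ R₁, 0 < R₁ ∧ R₁ ≤ R₁⋆ ∧ …` with the SAME
R-station radius hidden separately — a consumer cannot merge two existentials.  THIS FILE runs the R-station ONCE and concludes BOTH: displayed, for every `U₀` in
(3.35), the (3.35) data, `η`, `0 < Rc`, the G′ rate window, dag-n10-w5's X⁻¹ window, the R-loss `μ`, ONE dominating constant `B′` (`hBΔ : ∀ R, 0 < R → R ≤ Rc →
N(R) ≤ B′`, this seat's `B13GreenStationCoerciveLocated` §2 binder block byte-for-byte) and the centre's flat coercivity `hco` (or, by the lane's module 82, Theorem 3.11's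
clause `hpd` + Theorem 3.3's (3.46)–(3.47) form bound `hGB`, `m = B⁻¹`); concluded: the joint BALL FAMILY (coercivity `m − 2(B′c_V)R′∕R₁` on every `R′ ≤ R₁` AND the
letters `(R′, κ, 4∕m′)` under the window at `m′`), and its clean member at the half-margin radius `R′ = R₁·m∕(m + 4B′c_V)` (`PosDefTr` on the ball AND letters
`(R′, κ, 8∕m)` under the displayed window `16B′κc_V(½) ≤ m(ρ″−2μ)`; with print's two statements: constant `8B`).

[folklore] one `obtain` + positional applications of this seat's located theorems (`B13CoerciveAlongPencilLocated` §2, `B13InverseLettersOnCoerciveBallLocated` §2) + the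
half-margin arithmetic (`field_simp`, `nlinarith`, `gcongr`, `rawEntryLetters_mono`); kernel-checked; THEOREMS ONLY (no `def`, no `structure`, no instance, no notation;
`open scoped Matrix.Norms.L2Operator` = the record's norm); NOTHING of NODE 00's ∕ pv27's ∕ the lane's ∕ dag-n10-w2's ∕ dag-n10-w5's ∕ dag-n10-w6's ∕ n06-j's files is
modified; nothing here is a claim about the Yang–Mills mass gap; no node is discharged; count-neutral.

WHY THIS FILE (cell `pub-ymgap`, HUMAN RULING D-0062 ∕ D-0149, Track A node N10 = [B13]; WIDTH SEAT `pub-ymgap-dag-n10-w4` g6, CLAIM-5 (R455 (A)); lane owner dag-n10-c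
g16's census v21 items 1 and 3 and the lane's reading of the AtOne pair as «the A6 inhabitants of record for row 17's clause + the G-letters on an OPEN set of
backgrounds» (INBOX l.38392): this is the same joint statement around every coercive member of (3.35), with located constants, modulo the centre's `hco` — N06's).
WHICH reading the N10 term of record uses is NODE 00's ∕ def-T's word — NOT claimed here; LOCATED INSTANCES.

WHAT THIS FILE PROVES (all `theorem`s; `c_V = (d+1)N²c₀(1,ρ″−2μ)^{d+1}`, `c_V(½) = (d+1)N²c₀(1,(ρ″−2μ)∕2)^{d+1}`).
* ★★★★ `exists_coer_and_rawEntryLetters_GAY_recordV4_prodCfg_ballFamily_of_reg335_of_coer_centre_located` (joint ball family under ONE `∃ R₁`).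
* ★★★★ `exists_ball_posDefTr_and_rawEntryLetters_GAY_recordV4_prodCfg_of_reg335_of_coer_centre_located` (`0 < m`: clause on `‖A′‖ < R₁·m∕(m + 4B′c_V)` AND letters
  `(R₁·m∕(m + 4B′c_V), κ, 8∕m)`) · ★★★★ `exists_ball_posDefTr_and_rawEntryLetters_GAY_recordV4_prodCfg_of_reg335_of_posDefTr_of_formBound_located` (`hpd + hGB`, `m = B⁻¹`,
  constant `8B`).
HONEST FRAMING: located instances; finite-lattice constants, NOT print's `O(1)`; Theorems 3.1 ∕ 3.2 enter through dag-n10-w6's ∕ dag-n10-w5's ∕ dag-n10-w2's located stations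
(tree theorems on (3.35)); the centre's coercivity `hco`, resp. Theorem 3.11's clause `hpd` and Theorem 3.3's (3.46)–(3.47) form bound `hGB`, stay DISPLAYED (N06's, NOT in the
tree on (3.35)) — the clause is TRANSPORTED from a member to a ball, not proved for any member; chart balls; nothing of Bałaban's asserted; N06 ∕ N10 NOT discharged; K1⁹
stmt-QuantumFields-27364 OPEN, no registered stub proved; counts unmoved (typed 28∕28 · discharged 5∕27); 0 `def`, 0 `sorry`, standard axioms; one finite 𝕋⁴ programme at
fixed ε, Bałaban AS PRINTED — R4 closes the conditional finite-𝕋⁴ rung `BalabanLadder.UV` only; the YM mass gap (Clay) is NOT proved by any of this; nothing continuum ∕ ℝ⁴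
∕ OS.  Filed `--kind proof --supports stmt-QuantumFields-27364`, Literature lane.

References: T. Bałaban, CMP 99 (1985) 389–434 [Balaban1985BackgroundPropagators] (3.19)–(3.27) pp.393–395, (3.34)–(3.35) p.396, Thm 3.1 (3.42) p.397, Thm 3.2 (3.48)
p.398, (3.46)–(3.47) p.398, Thm 3.3 p.399, Thm 3.4 and (3.50) p.400, (3.62)–(3.64) p.402, (3.84)–(3.86) p.407, Thm 3.10 (3.107)–(3.108) pp.415–416, Thm 3.11 p.416; CMP 96
(1984) 223–250 [Balaban1984PropagatorsII] (2.19), p.226, Lemma 2.1 (2.61) p.234; CMP 116 (1988) 1–22 [Balaban1988RG2Cluster] (2.5)–(2.7) pp.12–13, p.15; M. Aizenman, S. Warzel,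
*Random Operators* (AMS 2015) §10.3 [AizenmanWarzel2015].
-/

noncomputable section

namespace Literature.MathematicalPhysics.QuantumFieldTheory.Balaban1983to89.B13ClauseAndGreenLettersOnBallReg335Located

open Metric Finset Module
open scoped Matrix Matrix.Norms.L2Operator
open Literature.MathematicalPhysics.QuantumFieldTheory.Balaban1983to89
open Literature.MathematicalPhysics.QuantumFieldTheory.Balaban1983to89.B9Thm37GlueTorus (tdist1)
open Literature.MathematicalPhysics.QuantumFieldTheory.Balaban1983to89.B5TorusCover (UT)
open Literature.MathematicalPhysics.QuantumFieldTheory.Balaban1983to89.B9Thm311ReadingCoords (trIP PosDefTr)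
open Literature.MathematicalPhysics.QuantumFieldTheory.Balaban1983to89.B13EntrywiseWalks (RawEntryLetters)
open Literature.MathematicalPhysics.QuantumFieldTheory.Balaban1983to89.B13EntryLetterAlgebra (rawEntryLetters_mono)
open Literature.MathematicalPhysics.QuantumFieldTheory.Balaban1983to89.B9Eq39Adjoint (prodCfg)
open Literature.MathematicalPhysics.QuantumFieldTheory.Balaban1983to89.B6GlobalChartV1 (PV)
open Literature.MathematicalPhysics.QuantumFieldTheory.Balaban1983to89.B6KLevelCensusIndexV1 (KIdx kGeo)
open Literature.MathematicalPhysics.QuantumFieldTheory.Balaban1983to89.B9BackgroundsKLevelV1 (bg9K)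
open Literature.MathematicalPhysics.QuantumFieldTheory.Balaban1983to89.Node00 (SiteY FBondY CfgY RY deltaAY GAY parBY parSymY GpY toKT)
open Literature.MathematicalPhysics.QuantumFieldTheory.Balaban1983to89.B13CoerciveOfInverseFormBound (trIP_deltaAY_parSymY_ge_of_posDefTr_of_GAY_formBound)
open Literature.MathematicalPhysics.QuantumFieldTheory.Balaban1983to89.B13InverseLettersOnCoerciveBallLocated
  (rawEntryLetters_toMatrix_deltaAY_parBY_prodCfg_of_pencil_located rawEntryLetters_toMatrix_GAY_parBY_prodCfg_ball_of_pencil_of_coercive_located)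
open Literature.MathematicalPhysics.QuantumFieldTheory.Balaban1983to89.B13CoerciveAlongPencilLocated
  (trIP_deltaAY_parBY_prodCfg_ge_of_pencil_of_coer_centre_located posDefTr_deltaAY_parBY_prodCfg_of_pencil_of_coer_centre_located)
open Literature.MathematicalPhysics.QuantumFieldTheory.Balaban1983to89.B13SiteReadingNumerals (fineReadingY)
open Literature.MathematicalPhysics.QuantumFieldTheory.Balaban1983to89.B13BlockBondReadingNumerals (bondReadingY)

variable {d ℓ : ℕ} {hd : 1 ≤ d + 1} {hL : Odd (ℓ + 1) ∧ 1 < ℓ + 1} {b₀ b₁ : ℝ}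
variable (i : KIdx d ℓ hd hL b₀ b₁) {N : ℕ} [NeZero N] {G : Subgroup (Matrix (Fin N) (Fin N) ℂ)ˣ}

/-- ★★★★ **COERCIVITY OF `Δ_a` AND THE LETTERS OF `G = Δ_a⁻¹` ON THE SAME CHART-BALL FAMILY AROUND EVERY COERCIVE MEMBER OF (3.35), BEHIND ONE HIDDEN RADIUS.**  For EVERY
`U₀ ∈ (bg9K (M_N ℂ) G i).Reg335 c α₀` (`G ≤ U(N)`, `0 ≤ c·M·α₀`, `c·M·α₀·(d+1) ≤ 1∕16`) at which `Δ_a(U₀)` is `m`-coercive: ONE R-station radius `0 < R₁ ≤ R₁⋆` (dag-n10-w2 g4 ∘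
dag-n10-w5 on (3.35), fine reading) serves BOTH `B13CoerciveAlongPencilLocated.trIP_deltaAY_parBY_prodCfg_ge_of_pencil_of_coer_centre_located` (module 83) AND
`B13InverseLettersOnCoerciveBallLocated.rawEntryLetters_toMatrix_GAY_parBY_prodCfg_ball_of_pencil_of_coercive_located` (module 84): `∃ R₁, 0 < R₁ ∧ R₁ ≤ R₁⋆ ∧ (∀ R′ ≤ R₁, ∀ ‖A′‖ < R′, ∀ Ψ,
(m − 2(B′c_V)R′∕R₁)⟨Ψ,Ψ⟩₁ ≤ ⟨Ψ, Δ_a(e^{iηA′}U₀)Ψ⟩₁) ∧ (∀ R′ κ, 0 ≤ R′ ≤ R₁ → 0 < m′ → 0 ≤ κ ≤ (ρ″−2μ)∕4 → 8B′κc_V(½) ≤ m′(ρ″−2μ) →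
RawEntryLetters (A′ ↦ toMatrix (G(e^{iηA′}U₀))) (bondReadingY ∘ fst) R′ κ (4∕m′))` (`c_V = (d+1)N²c₀(1,ρ″−2μ)^{d+1}`, `m′ = m − 2(B′c_V)R′∕R₁`) — this seat's
`B13CoerciveAlongPencilReg335Located` and `B13GreenChainOnCoerciveBallReg335Located` ball families under ONE existential (their separate `∃ R₁` cannot be merged by a consumer).
DISPLAYED ONLY: the (3.35) data, `η`, `0 < Rc`, the G′ rate window, the X⁻¹ window, the R-loss `0 < μ`, `2μ < ρ″`, `B′` with `hBΔ`, the centre's flat coercivity `hco`.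
[cite: Balaban1985BackgroundPropagators, (3.19)–(3.27) pp.393–395, (3.34)–(3.35) p.396, Thm 3.1 (3.42) p.397, Thm 3.2 (3.48) p.398, (3.46)–(3.47) p.398, Thm 3.3 p.399, Thm 3.4 and (3.50) p.400, (3.62)–(3.64) p.402, (3.84)–(3.86) p.407, Thm 3.10 (3.107)–(3.108) pp.415–416, Thm 3.11 p.416; Balaban1984PropagatorsII, (2.19) and p.226, Lemma 2.1 (2.61) p.234; Balaban1988RG2Cluster, (2.5)–(2.7) pp.12–13, p.15; AizenmanWarzel2015, §10.3] -/
theorem exists_coer_and_rawEntryLetters_GAY_recordV4_prodCfg_ballFamily_of_reg335_of_coer_centre_located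
    (hG : G ≤ B7Prop2Explicit.unitaryUnits (Matrix (Fin N) (Fin N) ℂ))
    {U₀ : CfgY (Matrix (Fin N) (Fin N) ℂ) i} {c α₀ : ℝ} (hC0 : 0 ≤ c * (kGeo i).M * α₀) (hC1 : c * (kGeo i).M * α₀ * ((d : ℝ) + 1) ≤ 1 / 16)
    (hreg : (bg9K (Matrix (Fin N) (Fin N) ℂ) G i).Reg335 c α₀ U₀)
    (η : ℝ) {Rc : ℝ} (hRc : 0 < Rc) {ρ' : ℝ} (hρ'0 : 0 ≤ ρ')
    (hρ' : ρ' < (1 / (4 * ((d : ℝ) + 2))) * ((((d : ℝ) + 1) * ((((ℓ + 1) ^ i.k : ℕ) : ℝ)))⁻¹))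
    {μX : ℝ} (hμX : 0 < μX) (hμρ : μX < ρ')
    {κX : ℝ} (hκX : 0 ≤ κX) (hκ4X : κX ≤ (ρ' - μX) / 4)
    (hκmX : 8 * (Real.sqrt ((((ℓ : ℝ) + 1) ^ i.k) ^ (d + 1)) *
        (1 * (Fintype.card (Fin N × Fin N) : ℝ) *
            (1 * ((1 * Real.exp (|η| * Rc)) ^ ((d + 1) * ((ℓ + 1) ^ i.k - 1)) * 1 * (1 * Real.exp (|η| * Rc)) ^ ((d + 1) * ((ℓ + 1) ^ i.k - 1)))) *
          ((((ℓ : ℝ) + 1) ^ i.k) ^ (d + 1) * (Fintype.card (Fin N × Fin N) : ℝ) *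
            (1 * ((1 * Real.exp (|η| * Rc)) ^ ((d + 1) * ((ℓ + 1) ^ i.k - 1)) * 1 * (1 * Real.exp (|η| * Rc)) ^ ((d + 1) * ((ℓ + 1) ^ i.k - 1))))) *
          ((2 * (1 * 1 * (16 * ((((ℓ + 1) ^ i.k : ℕ) : ℝ)) ^ 2 * Real.sqrt N))) * (2 * (1 * 1 * (16 * ((((ℓ + 1) ^ i.k : ℕ) : ℝ)) ^ 2 * Real.sqrt N))) *
            (((N * N : ℕ) : ℝ) * B6.c0 1 μX ^ (d + 1))) *
          Real.exp (2 * (ρ' - μX) * (((d : ℝ) + 1) * (((((ℓ + 1) ^ i.k : ℕ) : ℝ)) - 1))))) * κX *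
        (((N * N : ℕ) : ℝ) * B6.c0 1 ((ρ' - μX) / 2) ^ (d + 1)) ≤
      ((4 * ((d : ℝ) + 1) + 1) ^ 2)⁻¹ * (ρ' - μX))
    {ρ'' : ℝ} (hρ''0 : 0 ≤ ρ'') (hρ'' : ρ'' < κX)
    {μ : ℝ} (hμ : 0 < μ) (h2μ : 2 * μ < ρ'')
    {B' : ℝ}
    (hBΔ : ∀ R : ℝ, 0 < R → R ≤ Rc →
      1 * (((4 * ((d : ℝ) + 1) * |i.cf|) * ((1 * Real.exp (|η| * R)) * ((1 * Real.exp (|η| * R)) ^ 4 * ((4 * |i.cf|) * ((1 * Real.exp (|η| * R)) * 1 * (1 * Real.exp (|η| * R))))) * (1 * Real.exp (|η| * R))) + 1 / 2 * ((4 * ((d : ℝ) + 1)) * ((1 * Real.exp (|η| * R)) * (2 * (i.cf ^ 2 * (1 * Real.exp (|η| * R)) ^ 4) * (8 * ((1 * Real.exp (|η| * R)) * 1 * (1 * Real.exp (|η| * R))))) * (1 * Real.exp (|η| * R))))) + 2 * ((1 * Real.exp (|η| * R)) ^ ((d + 2) * ((ℓ + 1) ^ i.k - 1)) * ((|b₁|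 * i.cf ^ 2 * ((((ℓ + 1 : ℕ) : ℝ)) ^ i.k) ^ (d + 1)) * (1 * ((1 * Real.exp (|η| * R)) ^ ((d + 2) * ((ℓ + 1) ^ i.k - 1)) * 1 * (1 * Real.exp (|η| * R)) ^ ((d + 2) * ((ℓ + 1) ^ i.k - 1))))) * (1 * Real.exp (|η| * R)) ^ ((d + 2) * ((ℓ + 1) ^ i.k - 1)))) * Real.exp ((ρ'' - 2 * μ) * (2 * (((d : ℝ) + 2) * ((((ℓ + 1) ^ i.k : ℕ) : ℝ) - 1)))) +
          (2 * |i.cf|) * (Fintype.card (Fin N × Fin N) : ℝ) * (1 * ((1 * Real.exp (|η| * R)) * 1 * (1 * Real.exp (|η| * R)))) * ((2 * |i.cf|) * (Fintype.card (Fin N × Fin N) : ℝ) * (1 * ((1 * Real.exp (|η| * R)) * 1 * (1 * Real.exp (|η| * R))))) * (1 + 2 * (1 * 1 * (16 * ((((ℓ + 1) ^ i.k : ℕ) : ℝ)) ^ 2 * Real.sqrt N)) *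
            (1 * (Fintype.card (Fin N × Fin N) : ℝ) *
                (1 * ((1 * Real.exp (|η| * R)) ^ ((d + 1) * ((ℓ + 1) ^ i.k - 1)) * 1 * (1 * Real.exp (|η| * R)) ^ ((d + 1) * ((ℓ + 1) ^ i.k - 1)))) *
              (1 * (Fintype.card (Fin N × Fin N) : ℝ) *
                (1 * ((1 * Real.exp (|η| * R)) ^ ((d + 1) * ((ℓ + 1) ^ i.k - 1)) * 1 * (1 * Real.exp (|η| * R)) ^ ((d + 1) * ((ℓ + 1) ^ i.k - 1))))) *
              (2 * (1 * 1 * ((N : ℝ) ^ 3 * (Real.sqrt ((((ℓ : ℝ) + 1) ^ i.k) ^ (d + 1)) * (4 / ((4 * ((d : ℝ) + 1) + 1) ^ 2)⁻¹))))) *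
              Real.exp (2 * ρ'' * (((d : ℝ) + 1) * ((((ℓ + 1) ^ i.k : ℕ) : ℝ) - 1))) * (2 * (1 * 1 * (16 * ((((ℓ + 1) ^ i.k : ℕ) : ℝ)) ^ 2 * Real.sqrt N))) *
              (((N * N : ℕ) : ℝ) * B6.c0 1 μ ^ (d + 1))) *
            (((N * N : ℕ) : ℝ) * B6.c0 1 μ ^ (d + 1))) * Real.exp (2 * (ρ'' - 2 * μ) * 1) ≤ B')
    {m : ℝ}
    (hco : ∀ Ψ : FBondY i → Matrix (Fin N) (Fin N) ℂ,
      m * trIP (fun _ => (1 : ℝ)) Ψ Ψ ≤ trIP (fun _ => (1 : ℝ)) Ψ (deltaAY i (parSymY i) (parBY i) (GpY i (parSymY i)) U₀ Ψ)) :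
    ∃ R₁ : ℝ, 0 < R₁ ∧ R₁ ≤ Rc / (4 * ((1 * (((d : ℝ) + 1) * (1 * Real.exp (|η| * Rc) * (1 * Real.exp (|η| * Rc) * 1 * (1 * Real.exp (|η| * Rc)) + 1) * (1 * Real.exp (|η| * Rc)) +
            (1 * Real.exp (|η| * Rc) * 1 * (1 * Real.exp (|η| * Rc)) + 1)) + 1 * ((1 * Real.exp (|η| * Rc)) ^ (2 * (d + 1) * ((ℓ + 1) ^ i.k - 1)) * 1 * (1 * Real.exp (|η| * Rc)) ^ (2 * (d + 1) * ((ℓ + 1) ^ i.k - 1)))) *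
            Real.exp ((1 / (4 * ((d : ℝ) + 2)) * ((((d : ℝ) + 1) * ((((ℓ + 1) ^ i.k : ℕ) : ℝ)))⁻¹)) * (((d : ℝ) + 1) * ((((ℓ + 1) ^ i.k : ℕ) : ℝ))))) * (1 * 1 * (16 * ((((ℓ + 1) ^ i.k : ℕ) : ℝ)) ^ 2 * Real.sqrt N)) *
          (((N * N : ℕ) : ℝ) * B6.c0 1 (((1 / (4 * ((d : ℝ) + 2))) * ((((d : ℝ) + 1) * ((((ℓ + 1) ^ i.k : ℕ) : ℝ)))⁻¹) - ρ') / 3) ^ (d + 1)) *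
          (((N * N : ℕ) : ℝ) * B6.c0 1 (((1 / (4 * ((d : ℝ) + 2))) * ((((d : ℝ) + 1) * ((((ℓ + 1) ^ i.k : ℕ) : ℝ)))⁻¹) - ρ') / 3) ^ (d + 1))) + 1) ∧
  (∀ ⦃R' : ℝ⦄, 0 ≤ R' → R' ≤ R₁ → ∀ a ∈ ball (0 : Fin (d + 1) → Site (PV d ℓ i.m i.K hd hL) 0 → Matrix (Fin N) (Fin N) ℂ) R', ∀ Ψ : FBondY i → Matrix (Fin N) (Fin N) ℂ,
      (m - 2 * (B' * ((((d + 1) * (N * N) : ℕ) : ℝ) * B6.c0 1 (ρ'' - 2 * μ) ^ (d + 1))) * R' / R₁) * trIP (fun _ => (1 : ℝ)) Ψ Ψ ≤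
        trIP (fun _ => (1 : ℝ)) Ψ (deltaAY i (parSymY i) (parBY i) (GpY i (parSymY i)) (prodCfg U₀ η a) Ψ)) ∧
  ∀ ⦃R' κ : ℝ⦄, 0 ≤ R' → R' ≤ R₁ → 0 < m - 2 * (B' * ((((d + 1) * (N * N) : ℕ) : ℝ) * B6.c0 1 (ρ'' - 2 * μ) ^ (d + 1))) * R' / R₁ → 0 ≤ κ → κ ≤ (ρ'' - 2 * μ) / 4 →
    8 * B' * κ * ((((d + 1) * (N * N) : ℕ) : ℝ) * B6.c0 1 ((ρ'' - 2 * μ) / 2) ^ (d + 1)) ≤ (m - 2 * (B' * ((((d + 1) * (N * N) : ℕ) : ℝ) * B6.c0 1 (ρ'' - 2 * μ) ^ (d + 1))) * R' / R₁) * (ρ'' - 2 * μ) →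
  RawEntryLetters (fun a : Fin (d + 1) → Site (PV d ℓ i.m i.K hd hL) 0 → Matrix (Fin N) (Fin N) ℂ => LinearMap.toMatrix
          ((Pi.basis fun _ : FBondY i => Matrix.stdBasis ℂ (Fin N) (Fin N)).reindex (Equiv.sigmaEquivProd (FBondY i) (Fin N × Fin N))) ((Pi.basis fun _ : FBondY i => Matrix.stdBasis ℂ (Fin N) (Fin N)).reindex (Equiv.sigmaEquivProd (FBondY i) (Fin N × Fin N)))
          (GAY i (parSymY i) (parBY i) (GpY i (parSymY i)) (prodCfg U₀ η a))) (fun p : FBondY i × (Fin N × Fin N) => bondReadingY i i.hN p.1) R'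
      κ (4 / (m - 2 * (B' * ((((d + 1) * (N * N) : ℕ) : ℝ) * B6.c0 1 (ρ'' - 2 * μ) ^ (d + 1))) * R' / R₁)) := by
  -- R along the pencil on (3.35) at the fine reading, `hXi` discharged (dag-n10-w2 g4 ∘ dag-n10-w5), at some radius `0 < R₁ ≤ R₁⋆` — ONE radius for BOTH conclusions
  obtain ⟨R₁, hR₁, hR₁le, hR⟩ :=
    B13OpsYPencilRProjSymLocated.rawEntryLetters_toMatrix_RY_parSymY_prodCfg_of_reg335_located_of_xinvLocated i hG hC0 hC1 hreg η hRc hρ'0 hρ' hμX hμρ hκX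
      hκ4X hκmX hρ''0 hρ'' hμ h2μ.le
  -- `R₁⋆ ≤ Rc`: the thin radius divides `Rc` by `4T + 1 ≥ 1`
  have hT : 0 ≤ ((1 * (((d : ℝ) + 1) *
          (1 * Real.exp (|η| * Rc) * (1 * Real.exp (|η| * Rc) * 1 * (1 * Real.exp (|η| * Rc)) + 1) * (1 * Real.exp (|η| * Rc)) +
            (1 * Real.exp (|η| * Rc) * 1 * (1 * Real.exp (|η| * Rc)) + 1)) +
          1 * ((1 * Real.exp (|η| * Rc)) ^ (2 * (d + 1) * ((ℓ + 1) ^ i.k - 1)) * 1 * (1 * Real.exp (|η| * Rc)) ^ (2 * (d + 1) * ((ℓ + 1) ^ i.k - 1)))) *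
            Real.exp ((1 / (4 * ((d : ℝ) + 2)) * ((((d : ℝ) + 1) * ((((ℓ + 1) ^ i.k : ℕ) : ℝ)))⁻¹)) * (((d : ℝ) + 1) * ((((ℓ + 1) ^ i.k : ℕ) : ℝ))))) *
          (1 * 1 * (16 * ((((ℓ + 1) ^ i.k : ℕ) : ℝ)) ^ 2 * Real.sqrt N)) *
          (((N * N : ℕ) : ℝ) * B6.c0 1 (((1 / (4 * ((d : ℝ) + 2))) * ((((d : ℝ) + 1) * ((((ℓ + 1) ^ i.k : ℕ) : ℝ)))⁻¹) - ρ') / 3) ^ (d + 1)) *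
          (((N * N : ℕ) : ℝ) * B6.c0 1 (((1 / (4 * ((d : ℝ) + 2))) * ((((d : ℝ) + 1) * ((((ℓ + 1) ^ i.k : ℕ) : ℝ)))⁻¹) - ρ') / 3) ^ (d + 1))) :=
    mul_nonneg (mul_nonneg (mul_nonneg
      (mul_nonneg (mul_nonneg zero_le_one (add_nonneg (by positivity) (mul_nonneg zero_le_one (by positivity)))) (Real.exp_pos _).le)
      (by positivity)) (mul_nonneg (Nat.cast_nonneg _) (pow_nonneg (B6RandomWalk.c0_nonneg 1 _) _)))
      (mul_nonneg (Nat.cast_nonneg _) (pow_nonneg (B6RandomWalk.c0_nonneg 1 _) _))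
  have hR₁Rc : R₁ ≤ Rc := hR₁le.trans (div_le_self hRc.le (by linarith))
  have hρR : 0 < ρ'' - 2 * μ := by linarith
  exact ⟨R₁, hR₁, hR₁le,
    fun R' hR'0 hR'R => trIP_deltaAY_parBY_prodCfg_ge_of_pencil_of_coer_centre_located i (parSymY i) (GpY i (parSymY i)) hG hreg.1 i.hN η hR₁.le hρR hR
      (hBΔ R₁ hR₁ hR₁Rc) hco hR'0 hR'R,
    fun R' κ hR'0 hR'R hmarg hκ hκ4 hκm => rawEntryLetters_toMatrix_GAY_parBY_prodCfg_ball_of_pencil_of_coercive_located i (parSymY i) (GpY i (parSymY i)) hG hreg.1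
      i.hN η hR₁.le hρR hR (hBΔ R₁ hR₁ hR₁Rc) hco hR'0 hR'R hmarg hκ hκ4 hκm⟩

/-- ★★★★ **THEOREM 3.11's CLAUSE AND `G`'s (3.108)-LETTERS ON ONE LOCATED CHART BALL AROUND EVERY COERCIVE MEMBER OF (3.35)** — the clean member at the half-margin
radius `R′ = R₁·m∕(m + 4B′c_V)` (there `2(B′c_V)R′ < mR₁` AND the margin is `≥ m∕2`): with `0 < m` and the displayed window `0 ≤ κ ≤ (ρ″−2μ)∕4`, `16B′κc_V(½) ≤ m(ρ″−2μ)`,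
`∃ R₁, 0 < R₁ ∧ R₁ ≤ R₁⋆ ∧ (∀ ‖A′‖ < R′, PosDefTr 1 (Δ_a(e^{iηA′}U₀))) ∧ RawEntryLetters (A′ ↦ toMatrix (G(e^{iηA′}U₀))) (bondReadingY ∘ fst) R′ κ (8∕m)` — the
general-centre analogue, for the coercive members of (3.35), of dag-n10-w2 g4's `B13InverseLettersOnCoerciveBallAtOne.exists_ball_posDefTr_and_rawEntryLetters_toMatrix_GAY_recordV4_prodCfg_one`
(there `U₀ = 1` and NO displayed hypothesis; here the centre's `hco` displayed — N06's).
[cite: Balaban1985BackgroundPropagators, (3.19)–(3.27) pp.393–395, (3.34)–(3.35) p.396, Thm 3.1 (3.42) p.397, Thm 3.2 (3.48) p.398, (3.46)–(3.47) p.398, Thm 3.3 p.399, Thm 3.4 and (3.50) p.400, (3.62)–(3.64) p.402, (3.84)–(3.86) p.407, Thm 3.10 (3.107)–(3.108) pp.415–416, Thm 3.11 p.416; Balaban1984PropagatorsII, (2.19) and p.226, Lemma 2.1 (2.61) p.234; Balaban1988RG2Cluster, (2.5)–(2.7) pp.12–13, p.15; AizenmanWarzel2015, §10.3] -/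
theorem exists_ball_posDefTr_and_rawEntryLetters_GAY_recordV4_prodCfg_of_reg335_of_coer_centre_located
    (hG : G ≤ B7Prop2Explicit.unitaryUnits (Matrix (Fin N) (Fin N) ℂ))
    {U₀ : CfgY (Matrix (Fin N) (Fin N) ℂ) i} {c α₀ : ℝ} (hC0 : 0 ≤ c * (kGeo i).M * α₀) (hC1 : c * (kGeo i).M * α₀ * ((d : ℝ) + 1) ≤ 1 / 16)
    (hreg : (bg9K (Matrix (Fin N) (Fin N) ℂ) G i).Reg335 c α₀ U₀)
    (η : ℝ) {Rc : ℝ} (hRc : 0 < Rc) {ρ' : ℝ} (hρ'0 : 0 ≤ ρ')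
    (hρ' : ρ' < (1 / (4 * ((d : ℝ) + 2))) * ((((d : ℝ) + 1) * ((((ℓ + 1) ^ i.k : ℕ) : ℝ)))⁻¹))
    {μX : ℝ} (hμX : 0 < μX) (hμρ : μX < ρ')
    {κX : ℝ} (hκX : 0 ≤ κX) (hκ4X : κX ≤ (ρ' - μX) / 4)
    (hκmX : 8 * (Real.sqrt ((((ℓ : ℝ) + 1) ^ i.k) ^ (d + 1)) *
        (1 * (Fintype.card (Fin N × Fin N) : ℝ) *
            (1 * ((1 * Real.exp (|η| * Rc)) ^ ((d + 1) * ((ℓ + 1) ^ i.k - 1)) * 1 * (1 * Real.exp (|η| * Rc)) ^ ((d + 1) * ((ℓ + 1) ^ i.k - 1)))) *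
          ((((ℓ : ℝ) + 1) ^ i.k) ^ (d + 1) * (Fintype.card (Fin N × Fin N) : ℝ) *
            (1 * ((1 * Real.exp (|η| * Rc)) ^ ((d + 1) * ((ℓ + 1) ^ i.k - 1)) * 1 * (1 * Real.exp (|η| * Rc)) ^ ((d + 1) * ((ℓ + 1) ^ i.k - 1))))) *
          ((2 * (1 * 1 * (16 * ((((ℓ + 1) ^ i.k : ℕ) : ℝ)) ^ 2 * Real.sqrt N))) * (2 * (1 * 1 * (16 * ((((ℓ + 1) ^ i.k : ℕ) : ℝ)) ^ 2 * Real.sqrt N))) *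
            (((N * N : ℕ) : ℝ) * B6.c0 1 μX ^ (d + 1))) *
          Real.exp (2 * (ρ' - μX) * (((d : ℝ) + 1) * (((((ℓ + 1) ^ i.k : ℕ) : ℝ)) - 1))))) * κX *
        (((N * N : ℕ) : ℝ) * B6.c0 1 ((ρ' - μX) / 2) ^ (d + 1)) ≤
      ((4 * ((d : ℝ) + 1) + 1) ^ 2)⁻¹ * (ρ' - μX))
    {ρ'' : ℝ} (hρ''0 : 0 ≤ ρ'') (hρ'' : ρ'' < κX)
    {μ : ℝ} (hμ : 0 < μ) (h2μ : 2 * μ < ρ'')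
    {B' : ℝ}
    (hBΔ : ∀ R : ℝ, 0 < R → R ≤ Rc →
      1 * (((4 * ((d : ℝ) + 1) * |i.cf|) * ((1 * Real.exp (|η| * R)) * ((1 * Real.exp (|η| * R)) ^ 4 * ((4 * |i.cf|) * ((1 * Real.exp (|η| * R)) * 1 * (1 * Real.exp (|η| * R))))) * (1 * Real.exp (|η| * R))) + 1 / 2 * ((4 * ((d : ℝ) + 1)) * ((1 * Real.exp (|η| * R)) * (2 * (i.cf ^ 2 * (1 * Real.exp (|η| * R)) ^ 4) * (8 * ((1 * Real.exp (|η| * R)) * 1 * (1 * Real.exp (|η| * R))))) * (1 * Real.exp (|η| * R))))) + 2 * ((1 * Real.exp (|η| * R)) ^ ((d + 2) * ((ℓ + 1) ^ i.k - 1)) * ((|b₁| * i.cf ^ 2 * ((((ℓ + 1 : ℕ) : ℝ)) ^ i.k) ^ (d + 1)) * (1 * ((1 * Real.exp (|η| * R)) ^ ((d + 2) * ((ℓ + 1) ^ i.k - 1)) * 1 * (1 * Real.exp (|η| * R)) ^ ((d + 2) * ((ℓ + 1) ^ i.k - 1))))) * (1 * Real.exp (|η| * R)) ^ ((d + 2)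 * ((ℓ + 1) ^ i.k - 1)))) * Real.exp ((ρ'' - 2 * μ) * (2 * (((d : ℝ) + 2) * ((((ℓ + 1) ^ i.k : ℕ) : ℝ) - 1)))) +
          (2 * |i.cf|) * (Fintype.card (Fin N × Fin N) : ℝ) * (1 * ((1 * Real.exp (|η| * R)) * 1 * (1 * Real.exp (|η| * R)))) * ((2 * |i.cf|) * (Fintype.card (Fin N × Fin N) : ℝ) * (1 * ((1 * Real.exp (|η| * R)) * 1 * (1 * Real.exp (|η| * R))))) * (1 + 2 * (1 * 1 * (16 * ((((ℓ + 1) ^ i.k : ℕ) : ℝ)) ^ 2 * Real.sqrt N)) *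
            (1 * (Fintype.card (Fin N × Fin N) : ℝ) *
                (1 * ((1 * Real.exp (|η| * R)) ^ ((d + 1) * ((ℓ + 1) ^ i.k - 1)) * 1 * (1 * Real.exp (|η| * R)) ^ ((d + 1) * ((ℓ + 1) ^ i.k - 1)))) *
              (1 * (Fintype.card (Fin N × Fin N) : ℝ) *
                (1 * ((1 * Real.exp (|η| * R)) ^ ((d + 1) * ((ℓ + 1) ^ i.k - 1)) * 1 * (1 * Real.exp (|η| * R)) ^ ((d + 1) * ((ℓ + 1) ^ i.k - 1))))) *
              (2 * (1 * 1 * ((N : ℝ) ^ 3 * (Real.sqrt ((((ℓ : ℝ) + 1) ^ i.k) ^ (d + 1)) * (4 / ((4 * ((d : ℝ) + 1) + 1) ^ 2)⁻¹))))) *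
              Real.exp (2 * ρ'' * (((d : ℝ) + 1) * ((((ℓ + 1) ^ i.k : ℕ) : ℝ) - 1))) * (2 * (1 * 1 * (16 * ((((ℓ + 1) ^ i.k : ℕ) : ℝ)) ^ 2 * Real.sqrt N))) *
              (((N * N : ℕ) : ℝ) * B6.c0 1 μ ^ (d + 1))) *
            (((N * N : ℕ) : ℝ) * B6.c0 1 μ ^ (d + 1))) * Real.exp (2 * (ρ'' - 2 * μ) * 1) ≤ B')
    {m : ℝ} (hm : 0 < m)
    (hco : ∀ Ψ : FBondY i → Matrix (Fin N) (Fin N) ℂ,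
      m * trIP (fun _ => (1 : ℝ)) Ψ Ψ ≤ trIP (fun _ => (1 : ℝ)) Ψ (deltaAY i (parSymY i) (parBY i) (GpY i (parSymY i)) U₀ Ψ))
    {κ : ℝ} (hκ : 0 ≤ κ) (hκ4 : κ ≤ (ρ'' - 2 * μ) / 4)
    (hκm : 16 * B' * κ * ((((d + 1) * (N * N) : ℕ) : ℝ) * B6.c0 1 ((ρ'' - 2 * μ) / 2) ^ (d + 1)) ≤ m * (ρ'' - 2 * μ)) :
    ∃ R₁ : ℝ, 0 < R₁ ∧ R₁ ≤ Rc / (4 * ((1 * (((d : ℝ) + 1) * (1 * Real.exp (|η| * Rc) * (1 * Real.exp (|η| * Rc) * 1 * (1 * Real.exp (|η| * Rc)) + 1) * (1 * Real.exp (|η| * Rc)) +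
            (1 * Real.exp (|η| * Rc) * 1 * (1 * Real.exp (|η| * Rc)) + 1)) + 1 * ((1 * Real.exp (|η| * Rc)) ^ (2 * (d + 1) * ((ℓ + 1) ^ i.k - 1)) * 1 * (1 * Real.exp (|η| * Rc)) ^ (2 * (d + 1) * ((ℓ + 1) ^ i.k - 1)))) *
            Real.exp ((1 / (4 * ((d : ℝ) + 2)) * ((((d : ℝ) + 1) * ((((ℓ + 1) ^ i.k : ℕ) : ℝ)))⁻¹)) * (((d : ℝ) + 1) * ((((ℓ + 1) ^ i.k : ℕ) : ℝ))))) * (1 * 1 * (16 * ((((ℓ + 1) ^ i.k : ℕ) : ℝ)) ^ 2 * Real.sqrt N)) *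
          (((N * N : ℕ) : ℝ) * B6.c0 1 (((1 / (4 * ((d : ℝ) + 2))) * ((((d : ℝ) + 1) * ((((ℓ + 1) ^ i.k : ℕ) : ℝ)))⁻¹) - ρ') / 3) ^ (d + 1)) *
          (((N * N : ℕ) : ℝ) * B6.c0 1 (((1 / (4 * ((d : ℝ) + 2))) * ((((d : ℝ) + 1) * ((((ℓ + 1) ^ i.k : ℕ) : ℝ)))⁻¹) - ρ') / 3) ^ (d + 1))) + 1) ∧
  (∀ a ∈ ball (0 : Fin (d + 1) → Site (PV d ℓ i.m i.K hd hL) 0 → Matrix (Fin N) (Fin N) ℂ) (R₁ * (m / (m + 4 * (B' * ((((d + 1) * (N * N) : ℕ) : ℝ) * B6.c0 1 (ρ'' - 2 * μ) ^ (d + 1)))))),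
      PosDefTr (fun _ => (1 : ℝ)) (deltaAY i (parSymY i) (parBY i) (GpY i (parSymY i)) (prodCfg U₀ η a))) ∧
  RawEntryLetters (fun a : Fin (d + 1) → Site (PV d ℓ i.m i.K hd hL) 0 → Matrix (Fin N) (Fin N) ℂ => LinearMap.toMatrix
          ((Pi.basis fun _ : FBondY i => Matrix.stdBasis ℂ (Fin N) (Fin N)).reindex (Equiv.sigmaEquivProd (FBondY i) (Fin N × Fin N))) ((Pi.basis fun _ : FBondY i => Matrix.stdBasis ℂ (Fin N) (Fin N)).reindex (Equiv.sigmaEquivProd (FBondY i) (Fin N × Fin N)))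
          (GAY i (parSymY i) (parBY i) (GpY i (parSymY i)) (prodCfg U₀ η a))) (fun p : FBondY i × (Fin N × Fin N) => bondReadingY i i.hN p.1)
      (R₁ * (m / (m + 4 * (B' * ((((d + 1) * (N * N) : ℕ) : ℝ) * B6.c0 1 (ρ'' - 2 * μ) ^ (d + 1)))))) κ (8 / m) := by
  -- R along the pencil on (3.35) at the fine reading, `hXi` discharged (dag-n10-w2 g4 ∘ dag-n10-w5), at some radius `0 < R₁ ≤ R₁⋆` — ONE radius for BOTH conclusions
  obtain ⟨R₁, hR₁, hR₁le, hR⟩ :=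
    B13OpsYPencilRProjSymLocated.rawEntryLetters_toMatrix_RY_parSymY_prodCfg_of_reg335_located_of_xinvLocated i hG hC0 hC1 hreg η hRc hρ'0 hρ' hμX hμρ hκX
      hκ4X hκmX hρ''0 hρ'' hμ h2μ.le
  -- `R₁⋆ ≤ Rc`: the thin radius divides `Rc` by `4T + 1 ≥ 1`
  have hT : 0 ≤ ((1 * (((d : ℝ) + 1) *
          (1 * Real.exp (|η| * Rc) * (1 * Real.exp (|η| * Rc) * 1 * (1 * Real.exp (|η| * Rc)) + 1) * (1 * Real.exp (|η| * Rc)) +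
            (1 * Real.exp (|η| * Rc) * 1 * (1 * Real.exp (|η| * Rc)) + 1)) +
          1 * ((1 * Real.exp (|η| * Rc)) ^ (2 * (d + 1) * ((ℓ + 1) ^ i.k - 1)) * 1 * (1 * Real.exp (|η| * Rc)) ^ (2 * (d + 1) * ((ℓ + 1) ^ i.k - 1)))) *
            Real.exp ((1 / (4 * ((d : ℝ) + 2)) * ((((d : ℝ) + 1) * ((((ℓ + 1) ^ i.k : ℕ) : ℝ)))⁻¹)) * (((d : ℝ) + 1) * ((((ℓ + 1) ^ i.k : ℕ) : ℝ))))) *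
          (1 * 1 * (16 * ((((ℓ + 1) ^ i.k : ℕ) : ℝ)) ^ 2 * Real.sqrt N)) *
          (((N * N : ℕ) : ℝ) * B6.c0 1 (((1 / (4 * ((d : ℝ) + 2))) * ((((d : ℝ) + 1) * ((((ℓ + 1) ^ i.k : ℕ) : ℝ)))⁻¹) - ρ') / 3) ^ (d + 1)) *
          (((N * N : ℕ) : ℝ) * B6.c0 1 (((1 / (4 * ((d : ℝ) + 2))) * ((((d : ℝ) + 1) * ((((ℓ + 1) ^ i.k : ℕ) : ℝ)))⁻¹) - ρ') / 3) ^ (d + 1))) :=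
    mul_nonneg (mul_nonneg (mul_nonneg
      (mul_nonneg (mul_nonneg zero_le_one (add_nonneg (by positivity) (mul_nonneg zero_le_one (by positivity)))) (Real.exp_pos _).le)
      (by positivity)) (mul_nonneg (Nat.cast_nonneg _) (pow_nonneg (B6RandomWalk.c0_nonneg 1 _) _)))
      (mul_nonneg (Nat.cast_nonneg _) (pow_nonneg (B6RandomWalk.c0_nonneg 1 _) _))
  have hR₁Rc : R₁ ≤ Rc := hR₁le.trans (div_le_self hRc.le (by linarith))
  have hρR : 0 < ρ'' - 2 * μ := by linarith
  -- Δ_a's letters at the record (for `0 ≤ B′`) and the numeral `c_V ≥ 0`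
  have hA := rawEntryLetters_toMatrix_deltaAY_parBY_prodCfg_of_pencil_located i (parSymY i) (GpY i (parSymY i)) hG hreg.1 i.hN η hR₁.le hρR.le hR
  have hB'0 : 0 ≤ B' := hA.B_nonneg.trans (hBΔ R₁ hR₁ hR₁Rc)
  set cV : ℝ := ((((d + 1) * (N * N) : ℕ) : ℝ) * B6.c0 1 (ρ'' - 2 * μ) ^ (d + 1)) with hcV
  have hcV0 : 0 ≤ cV := mul_nonneg (Nat.cast_nonneg _) (pow_nonneg (B6RandomWalk.c0_nonneg 1 _) _)
  have hc : 0 ≤ B' * cV := mul_nonneg hB'0 hcV0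
  have hden : 0 < m + 4 * (B' * cV) := by positivity
  have hq0 : 0 ≤ m / (m + 4 * (B' * cV)) := div_nonneg hm.le hden.le
  have hq1 : m / (m + 4 * (B' * cV)) ≤ 1 := by rw [div_le_one hden]; linarith
  have hR'0 : 0 ≤ R₁ * (m / (m + 4 * (B' * cV))) := mul_nonneg hR₁.le hq0
  have hR'R : R₁ * (m / (m + 4 * (B' * cV))) ≤ R₁ := mul_le_of_le_one_right hR₁.le hq1
  -- the clause: `2(B′c_V)R′ < m·R₁`
  have hsmall : 2 * (B' * cV) * (R₁ * (m / (m + 4 * (B' * cV)))) < m * R₁ := by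
    have h1 : 2 * (B' * cV) * (R₁ * (m / (m + 4 * (B' * cV)))) = (2 * (B' * cV) / (m + 4 * (B' * cV))) * (m * R₁) := by
      field_simp
    have h2 : 2 * (B' * cV) / (m + 4 * (B' * cV)) < 1 := by rw [div_lt_one hden]; linarith
    rw [h1]
    exact mul_lt_of_lt_one_left (mul_pos hm hR₁) h2
  -- the letters: margin `≥ m∕2` at the half-margin radius, window halved, constant `4∕m′ ≤ 8∕m`
  have hkey : 2 * (B' * cV) * (R₁ * (m / (m + 4 * (B' * cV)))) / R₁ = 2 * (B' * cV) * m / (m + 4 * (B' * cV)) := by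
    field_simp
  have hm' : m / 2 ≤ m - 2 * (B' * cV) * (R₁ * (m / (m + 4 * (B' * cV)))) / R₁ := by
    rw [hkey]
    have h1 : 2 * (B' * cV) * m / (m + 4 * (B' * cV)) ≤ m / 2 := by
      rw [div_le_iff₀ hden]
      nlinarith [sq_nonneg m, hc, hm.le]
    linarith
  have hmarg : 0 < m - 2 * (B' * cV) * (R₁ * (m / (m + 4 * (B' * cV)))) / R₁ := lt_of_lt_of_le (half_pos hm) hm'
  have hκm' : 8 * B' * κ * ((((d + 1) * (N * N) : ℕ) : ℝ) * B6.c0 1 ((ρ'' - 2 * μ) / 2) ^ (d + 1)) ≤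
      (m - 2 * (B' * cV) * (R₁ * (m / (m + 4 * (B' * cV)))) / R₁) * (ρ'' - 2 * μ) :=
    calc 8 * B' * κ * ((((d + 1) * (N * N) : ℕ) : ℝ) * B6.c0 1 ((ρ'' - 2 * μ) / 2) ^ (d + 1))
        = (16 * B' * κ * ((((d + 1) * (N * N) : ℕ) : ℝ) * B6.c0 1 ((ρ'' - 2 * μ) / 2) ^ (d + 1))) / 2 := by ring
      _ ≤ (m * (ρ'' - 2 * μ)) / 2 := by gcongr
      _ = (m / 2) * (ρ'' - 2 * μ) := by ring
      _ ≤ _ := mul_le_mul_of_nonneg_right hm' hρR.le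
  have h := rawEntryLetters_toMatrix_GAY_parBY_prodCfg_ball_of_pencil_of_coercive_located i (parSymY i) (GpY i (parSymY i)) hG hreg.1 i.hN η hR₁.le hρR hR
    (hBΔ R₁ hR₁ hR₁Rc) hco hR'0 hR'R hmarg hκ hκ4 hκm'
  have h48 : 4 / (m - 2 * (B' * cV) * (R₁ * (m / (m + 4 * (B' * cV)))) / R₁) ≤ 8 / m := by
    rw [div_le_div_iff₀ hmarg hm]
    linarith
  exact ⟨R₁, hR₁, hR₁le, posDefTr_deltaAY_parBY_prodCfg_of_pencil_of_coer_centre_located i (parSymY i) (GpY i (parSymY i)) hG hreg.1 i.hN η hR₁.le hρR hR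
    (hBΔ R₁ hR₁ hR₁Rc) hm hco hR'0 hR'R hsmall, rawEntryLetters_mono h le_rfl le_rfl h48⟩

/-- ★★★★ **… WITH THE CENTRE FROM PRINT's TWO STATEMENTS** (`m = B⁻¹` by module 82 §2 from Theorem 3.11's clause `PosDefTr 1 (Δ_a(U₀))` and Theorem 3.3's (3.46)–(3.47)
form bound `⟨Φ, G(U₀)Φ⟩₁ ≤ B⟨Φ,Φ⟩₁`, `0 < B`): for EVERY member `U₀` of (3.35) at which print's two statements hold, on the ONE located chart ball of radius
`R′ = R₁·B⁻¹∕(B⁻¹ + 4B′c_V)`: Theorem 3.11's clause holds at every point AND `G`'s (3.108)-letters `(R′, κ, 8B)` hold — print's two statements AT ONE BACKGROUND carry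
themselves (the clause) and the G-junction (the letters) to a whole located ball; window `16B′κc_V(½) ≤ B⁻¹(ρ″−2μ)`.
[cite: Balaban1985BackgroundPropagators, (3.19)–(3.27) pp.393–395, (3.34)–(3.35) p.396, Thm 3.1 (3.42) p.397, Thm 3.2 (3.48) p.398, (3.46)–(3.47) p.398, Thm 3.3 p.399, Thm 3.4 and (3.50) p.400, (3.62)–(3.64) p.402, (3.84)–(3.86) p.407, Thm 3.10 (3.107)–(3.108) pp.415–416, Thm 3.11 p.416; Balaban1984PropagatorsII, (2.19) and p.226, Lemma 2.1 (2.61) p.234; Balaban1988RG2Cluster, (2.5)–(2.7) pp.12–13, p.15; AizenmanWarzel2015, §10.3] -/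
theorem exists_ball_posDefTr_and_rawEntryLetters_GAY_recordV4_prodCfg_of_reg335_of_posDefTr_of_formBound_located
    (hG : G ≤ B7Prop2Explicit.unitaryUnits (Matrix (Fin N) (Fin N) ℂ))
    {U₀ : CfgY (Matrix (Fin N) (Fin N) ℂ) i} {c α₀ : ℝ} (hC0 : 0 ≤ c * (kGeo i).M * α₀) (hC1 : c * (kGeo i).M * α₀ * ((d : ℝ) + 1) ≤ 1 / 16)
    (hreg : (bg9K (Matrix (Fin N) (Fin N) ℂ) G i).Reg335 c α₀ U₀)
    (η : ℝ) {Rc : ℝ} (hRc : 0 < Rc) {ρ' : ℝ} (hρ'0 : 0 ≤ ρ')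
    (hρ' : ρ' < (1 / (4 * ((d : ℝ) + 2))) * ((((d : ℝ) + 1) * ((((ℓ + 1) ^ i.k : ℕ) : ℝ)))⁻¹))
    {μX : ℝ} (hμX : 0 < μX) (hμρ : μX < ρ')
    {κX : ℝ} (hκX : 0 ≤ κX) (hκ4X : κX ≤ (ρ' - μX) / 4)
    (hκmX : 8 * (Real.sqrt ((((ℓ : ℝ) + 1) ^ i.k) ^ (d + 1)) *
        (1 * (Fintype.card (Fin N × Fin N) : ℝ) *
            (1 * ((1 * Real.exp (|η| * Rc)) ^ ((d + 1) * ((ℓ + 1) ^ i.k - 1)) * 1 * (1 * Real.exp (|η| * Rc)) ^ ((d + 1) * ((ℓ + 1) ^ i.k - 1)))) *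
          ((((ℓ : ℝ) + 1) ^ i.k) ^ (d + 1) * (Fintype.card (Fin N × Fin N) : ℝ) *
            (1 * ((1 * Real.exp (|η| * Rc)) ^ ((d + 1) * ((ℓ + 1) ^ i.k - 1)) * 1 * (1 * Real.exp (|η| * Rc)) ^ ((d + 1) * ((ℓ + 1) ^ i.k - 1))))) *
          ((2 * (1 * 1 * (16 * ((((ℓ + 1) ^ i.k : ℕ) : ℝ)) ^ 2 * Real.sqrt N))) * (2 * (1 * 1 * (16 * ((((ℓ + 1) ^ i.k : ℕ) : ℝ)) ^ 2 * Real.sqrt N))) *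
            (((N * N : ℕ) : ℝ) * B6.c0 1 μX ^ (d + 1))) *
          Real.exp (2 * (ρ' - μX) * (((d : ℝ) + 1) * (((((ℓ + 1) ^ i.k : ℕ) : ℝ)) - 1))))) * κX *
        (((N * N : ℕ) : ℝ) * B6.c0 1 ((ρ' - μX) / 2) ^ (d + 1)) ≤
      ((4 * ((d : ℝ) + 1) + 1) ^ 2)⁻¹ * (ρ' - μX))
    {ρ'' : ℝ} (hρ''0 : 0 ≤ ρ'') (hρ'' : ρ'' < κX)
    {μ : ℝ} (hμ : 0 < μ) (h2μ : 2 * μ < ρ'')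
    {B' : ℝ}
    (hBΔ : ∀ R : ℝ, 0 < R → R ≤ Rc →
      1 * (((4 * ((d : ℝ) + 1) * |i.cf|) * ((1 * Real.exp (|η| * R)) * ((1 * Real.exp (|η| * R)) ^ 4 * ((4 * |i.cf|) * ((1 * Real.exp (|η| * R)) * 1 * (1 * Real.exp (|η| * R))))) * (1 * Real.exp (|η| * R))) + 1 / 2 * ((4 * ((d : ℝ) + 1)) * ((1 * Real.exp (|η| * R)) * (2 * (i.cf ^ 2 * (1 * Real.exp (|η| * R)) ^ 4) * (8 * ((1 * Real.exp (|η| * R)) * 1 * (1 * Real.exp (|η| * R))))) * (1 * Real.exp (|η| * R))))) + 2 * ((1 * Real.exp (|η| * R)) ^ ((d + 2) * ((ℓ + 1) ^ i.k - 1)) * ((|b₁| * i.cf ^ 2 * ((((ℓ + 1 : ℕ) : ℝ)) ^ i.k) ^ (d + 1)) * (1 * ((1 * Real.exp (|η| * R)) ^ ((d + 2) * ((ℓ + 1) ^ i.k - 1)) * 1 * (1 * Real.exp (|η| * R)) ^ ((d + 2) * ((ℓ + 1) ^ i.k - 1))))) * (1 * Real.exp (|η| * R)) ^ ((d + 2)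 * ((ℓ + 1) ^ i.k - 1)))) * Real.exp ((ρ'' - 2 * μ) * (2 * (((d : ℝ) + 2) * ((((ℓ + 1) ^ i.k : ℕ) : ℝ) - 1)))) +
          (2 * |i.cf|) * (Fintype.card (Fin N × Fin N) : ℝ) * (1 * ((1 * Real.exp (|η| * R)) * 1 * (1 * Real.exp (|η| * R)))) * ((2 * |i.cf|) * (Fintype.card (Fin N × Fin N) : ℝ) * (1 * ((1 * Real.exp (|η| * R)) * 1 * (1 * Real.exp (|η| * R))))) * (1 + 2 * (1 * 1 * (16 * ((((ℓ + 1) ^ i.k : ℕ) : ℝ)) ^ 2 * Real.sqrt N)) *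
            (1 * (Fintype.card (Fin N × Fin N) : ℝ) *
                (1 * ((1 * Real.exp (|η| * R)) ^ ((d + 1) * ((ℓ + 1) ^ i.k - 1)) * 1 * (1 * Real.exp (|η| * R)) ^ ((d + 1) * ((ℓ + 1) ^ i.k - 1)))) *
              (1 * (Fintype.card (Fin N × Fin N) : ℝ) *
                (1 * ((1 * Real.exp (|η| * R)) ^ ((d + 1) * ((ℓ + 1) ^ i.k - 1)) * 1 * (1 * Real.exp (|η| * R)) ^ ((d + 1) * ((ℓ + 1) ^ i.k - 1))))) *
              (2 * (1 * 1 * ((N : ℝ) ^ 3 * (Real.sqrt ((((ℓ : ℝ) + 1) ^ i.k) ^ (d + 1)) * (4 / ((4 * ((d : ℝ) + 1) + 1) ^ 2)⁻¹))))) *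
              Real.exp (2 * ρ'' * (((d : ℝ) + 1) * ((((ℓ + 1) ^ i.k : ℕ) : ℝ) - 1))) * (2 * (1 * 1 * (16 * ((((ℓ + 1) ^ i.k : ℕ) : ℝ)) ^ 2 * Real.sqrt N))) *
              (((N * N : ℕ) : ℝ) * B6.c0 1 μ ^ (d + 1))) *
            (((N * N : ℕ) : ℝ) * B6.c0 1 μ ^ (d + 1))) * Real.exp (2 * (ρ'' - 2 * μ) * 1) ≤ B')
    -- print's two statements at the centre: Theorem 3.11's clause (row 17) and Theorem 3.3's (3.46)–(3.47) for `G`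
    (hpd : PosDefTr (fun _ => (1 : ℝ)) (deltaAY i (parSymY i) (parBY i) (GpY i (parSymY i)) U₀))
    {B : ℝ} (hB : 0 < B)
    (hGB : ∀ Φ : FBondY i → Matrix (Fin N) (Fin N) ℂ,
      trIP (fun _ => (1 : ℝ)) Φ (GAY i (parSymY i) (parBY i) (GpY i (parSymY i)) U₀ Φ) ≤ B * trIP (fun _ => (1 : ℝ)) Φ Φ)
    {κ : ℝ} (hκ : 0 ≤ κ) (hκ4 : κ ≤ (ρ'' - 2 * μ) / 4)
    (hκm : 16 * B' * κ * ((((d + 1) * (N * N) : ℕ) : ℝ) * B6.c0 1 ((ρ'' - 2 * μ) / 2) ^ (d + 1)) ≤ B⁻¹ * (ρ'' - 2 * μ)) :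
    ∃ R₁ : ℝ, 0 < R₁ ∧ R₁ ≤ Rc / (4 * ((1 * (((d : ℝ) + 1) * (1 * Real.exp (|η| * Rc) * (1 * Real.exp (|η| * Rc) * 1 * (1 * Real.exp (|η| * Rc)) + 1) * (1 * Real.exp (|η| * Rc)) +
            (1 * Real.exp (|η| * Rc) * 1 * (1 * Real.exp (|η| * Rc)) + 1)) + 1 * ((1 * Real.exp (|η| * Rc)) ^ (2 * (d + 1) * ((ℓ + 1) ^ i.k - 1)) * 1 * (1 * Real.exp (|η| * Rc)) ^ (2 * (d + 1) * ((ℓ + 1) ^ i.k - 1)))) *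
            Real.exp ((1 / (4 * ((d : ℝ) + 2)) * ((((d : ℝ) + 1) * ((((ℓ + 1) ^ i.k : ℕ) : ℝ)))⁻¹)) * (((d : ℝ) + 1) * ((((ℓ + 1) ^ i.k : ℕ) : ℝ))))) * (1 * 1 * (16 * ((((ℓ + 1) ^ i.k : ℕ) : ℝ)) ^ 2 * Real.sqrt N)) *
          (((N * N : ℕ) : ℝ) * B6.c0 1 (((1 / (4 * ((d : ℝ) + 2))) * ((((d : ℝ) + 1) * ((((ℓ + 1) ^ i.k : ℕ) : ℝ)))⁻¹) - ρ') / 3) ^ (d + 1)) *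
          (((N * N : ℕ) : ℝ) * B6.c0 1 (((1 / (4 * ((d : ℝ) + 2))) * ((((d : ℝ) + 1) * ((((ℓ + 1) ^ i.k : ℕ) : ℝ)))⁻¹) - ρ') / 3) ^ (d + 1))) + 1) ∧
  (∀ a ∈ ball (0 : Fin (d + 1) → Site (PV d ℓ i.m i.K hd hL) 0 → Matrix (Fin N) (Fin N) ℂ) (R₁ * (B⁻¹ / (B⁻¹ + 4 * (B' * ((((d + 1) * (N * N) : ℕ) : ℝ) * B6.c0 1 (ρ'' - 2 * μ) ^ (d + 1)))))),
      PosDefTr (fun _ => (1 : ℝ)) (deltaAY i (parSymY i) (parBY i) (GpY i (parSymY i)) (prodCfg U₀ η a))) ∧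
  RawEntryLetters (fun a : Fin (d + 1) → Site (PV d ℓ i.m i.K hd hL) 0 → Matrix (Fin N) (Fin N) ℂ => LinearMap.toMatrix
          ((Pi.basis fun _ : FBondY i => Matrix.stdBasis ℂ (Fin N) (Fin N)).reindex (Equiv.sigmaEquivProd (FBondY i) (Fin N × Fin N))) ((Pi.basis fun _ : FBondY i => Matrix.stdBasis ℂ (Fin N) (Fin N)).reindex (Equiv.sigmaEquivProd (FBondY i) (Fin N × Fin N)))
          (GAY i (parSymY i) (parBY i) (GpY i (parSymY i)) (prodCfg U₀ η a))) (fun p : FBondY i × (Fin N × Fin N) => bondReadingY i i.hN p.1)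
      (R₁ * (B⁻¹ / (B⁻¹ + 4 * (B' * ((((d + 1) * (N * N) : ℕ) : ℝ) * B6.c0 1 (ρ'' - 2 * μ) ^ (d + 1)))))) κ (8 * B) := by
  obtain ⟨R₁, hR₁, hR₁le, hpd', h⟩ := exists_ball_posDefTr_and_rawEntryLetters_GAY_recordV4_prodCfg_of_reg335_of_coer_centre_located i hG hC0 hC1 hreg η hRc hρ'0
    hρ' hμX hμρ hκX hκ4X hκmX hρ''0 hρ'' hμ h2μ hBΔ (inv_pos.mpr hB) (trIP_deltaAY_parSymY_ge_of_posDefTr_of_GAY_formBound i hG hreg.1 hpd hB hGB) hκ hκ4 hκm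
  exact ⟨R₁, hR₁, hR₁le, hpd', by simpa only [div_inv_eq_mul] using h⟩

end Literature.MathematicalPhysics.QuantumFieldTheory.Balaban1983to89.B13ClauseAndGreenLettersOnBallReg335Located

end
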